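import Literature.Analysis.SpecialFunctions.EllipticKAGM
import Literature.Probability.RandomPlanarGeometry.KlebanZagierTheorem2
import HarnessLib

/-!
# Landen's transformation of the thetanulls and Jacobi's inversion theorem
# `K(k) = (π/2) ϑ₃(q)²`, `K′(k)/K(k) = y` for `q = e^{-πy}`

Topic `Literature/Analysis/SpecialFunctions` (sequel of `EllipticKAGM.lean`: Gauss's
`K(1 − b²/a²) = πa/(2M(a,b))`). The thetanulls are the tree's
`Literature.NumberTheory.EllipticCurves.JacobiThetaNull.theta2/3/4` (built from Mathlib's
`jacobiTheta₂`; `JacobiThetaDerivativeFormula.lean`, `JacobiThetaQuartic.lean`), the elliptic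
modulus on the imaginary axis is `KlebanZagier.lamR t = ϑ₂(it)⁴/ϑ₃(it)⁴ = modularLambdaI t`
(`KlebanZagierTheorem2.lean`: `lamR_mem_Ioo`, `one_sub_lamR`, `lamR_inv`), and the complete
elliptic integral is `Literature.Probability.RandomPlanarGeometry.ellipticK` (parameter
convention `K(u) = ∫₀¹ dt/√((1−t²)(1−ut²))`, so `K(k) = ellipticK (k²)`). Everything is classical
(Lawden, *Elliptic Functions and Applications*, §1.8, §2.1–2.2, §3.1) and PROVED; no named fact
and no definition is introduced.

* **Landen's transformation of the thetanulls** (Lawden (1.8.2), (1.8.4) at `x = 0`, and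
  (1.8.5)–(1.8.7)): for every `τ : ℂ`,
  `ϑ₃(τ)² = ϑ₃(2τ)² + ϑ₂(2τ)²`, `ϑ₄(τ)² = ϑ₃(2τ)² − ϑ₂(2τ)²`, `ϑ₃(τ)ϑ₄(τ) = ϑ₄(2τ)²`, hence
  `ϑ₃(2τ)² = (ϑ₃² + ϑ₄²)/2`, `ϑ₂(2τ)² = (ϑ₃² − ϑ₄²)/2`, `ϑ₄(2τ)² = ϑ₃ϑ₄` — proved from the
  double series by splitting `ℤ²` into the two parity classes `(a+b, a−b)`, `(a+b+1, a−b)`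
  (off the upper half-plane both sides vanish);
* hence on the imaginary axis the squares `(ϑ₃(iy)², ϑ₄(iy)²)` perform exactly one AGM step when
  `y ↦ 2y` (`agmSequences_thetaSq`), and since `ϑ₃, ϑ₄ → 1` at `i∞`, `M(ϑ₃(iy)², ϑ₄(iy)²) = 1`
  (`agm_thetaSq_eq_one`);
* **Jacobi's inversion theorem on the imaginary axis** (Lawden (2.1.7), (2.2.3) with (3.1.3),
  (3.1.4)): for `y > 0`, with `λ(iy) = ϑ₂(iy)⁴/ϑ₃(iy)⁴ = k²`,
  `ellipticK_lamR : K(k) = ellipticK (λ(iy)) = (π/2) ϑ₃(iy)²` (Gauss's theorem of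
  `EllipticKAGM.lean` at `(a,b) = (ϑ₃², ϑ₄²)` plus Jacobi's quartic identity), and
  `ellipticK_one_sub_lamR : K′(k) = ellipticK (1 − λ(iy)) = y · ellipticK (λ(iy))`
  (from `λ(i/y) = 1 − λ(iy)` and `ϑ₃(i/y)² = y ϑ₃(iy)²`), i.e. `K′/K = y`, `q = e^{−πK′/K}`;
* **singular moduli as theta quotients**: for `N > 0` the unique modulus `0 < k_N < 1` with
  `K′(k_N) = √N K(k_N)` (tree: `existsUnique_singularModulus`) is `k_N = √λ(i√N)`, and
  `K(k_N) = (π/2) ϑ₃(i√N)²` (`singularModulus_sq_eq_lamR`, `ellipticK_singularModulus_eq`).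
  This is the bridge between the `ellipticK`-typed singular values of the tree (e.g. the `K₁₅`
  of `Literature.Analysis.FunctionSpaces.BorweinStraubWanZudilin2012_eq_5_3`) and thetanull /
  eta values at CM points, where Chowla–Selberg evaluations live.

## References

* D. F. Lawden, *Elliptic Functions and Applications*, Springer (1989): §1.8 eqs. (1.8.2)–(1.8.7)
  (Landen's transformation of theta functions, PDF pp. 54–55), §2.1 eq. (2.1.7)
  (`k = ϑ₂²/ϑ₃²`, `k′ = ϑ₄²/ϑ₃²`), §2.2 eq. (2.2.3) (`K = ½πϑ₃²(0)`, `iK′ = τK`), §3.1 eqs.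
  (3.1.3)–(3.1.4) (`K = ∫₀¹ dt/√((1−t²)(1−k²t²))`, `K′(k) = K(k′)`). [Lawden1989]
* J. M. Borwein, P. B. Borwein, *Pi and the AGM*, Wiley (1987), §2.1, Thm 2.1 / (2.1.13)
  (the theta AGM), Thm 2.3. [BorweinBorwein1987]
-/

noncomputable section

open Complex Real Filter Topology NNReal
open scoped Real NNReal

namespace Literature.Analysis.SpecialFunctions

open Literature.NumberTheory.EllipticCurves.JacobiThetaNull
open Literature.Probability.RandomPlanarGeometry
open Literature.Probability.RandomPlanarGeometry.KlebanZagier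

/-! ### Bookkeeping: the parity splitting of `ℤ²` and exponential identities -/

/-- The opposite-parity reparametrisation `(a,b) ↦ (a+b+1, a−b)` of `ℤ²` is injective. [folklore] -/
theorem parity_inr_injective :
    Function.Injective fun p : ℤ × ℤ => (p.1 + p.2 + 1, p.1 - p.2) := by
  rintro ⟨a, b⟩ ⟨c, d⟩ h
  simp only [Prod.mk.injEq] at h
  ext <;> dsimp only <;> omega

/-- **Parity splitting of a double series**: if the equal-parity part
`(a,b) ↦ F(a+b, a−b)` sums to `s₁` and the opposite-parity part `(a,b) ↦ F(a+b+1, a−b)` sums to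
`s₂`, then `F` sums to `s₁ + s₂` over `ℤ²` (the two maps together form a bijection
`ℤ² ⊕ ℤ² ≃ ℤ²`). [folklore] -/
theorem hasSum_parity_split {F : ℤ × ℤ → ℂ} {s₁ s₂ : ℂ}
    (h₁ : HasSum (fun p : ℤ × ℤ => F (p.1 + p.2, p.1 - p.2)) s₁)
    (h₂ : HasSum (fun p : ℤ × ℤ => F (p.1 + p.2 + 1, p.1 - p.2)) s₂) :
    HasSum F (s₁ + s₂) := by
  let fwd : (ℤ × ℤ) ⊕ (ℤ × ℤ) → ℤ × ℤ := fun s =>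
    match s with
    | Sum.inl p => (p.1 + p.2, p.1 - p.2)
    | Sum.inr p => (p.1 + p.2 + 1, p.1 - p.2)
  let bwd : ℤ × ℤ → (ℤ × ℤ) ⊕ (ℤ × ℤ) := fun q =>
    if (q.1 + q.2) % 2 = 0 then Sum.inl ((q.1 + q.2) / 2, (q.1 - q.2) / 2)
    else Sum.inr ((q.1 + q.2 - 1) / 2, (q.1 - q.2 - 1) / 2)
  have hlr : Function.LeftInverse bwd fwd := by
    rintro (⟨a, b⟩ | ⟨a, b⟩)
    · show bwd (a + b, a - b) = Sum.inl (a, b)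
      have h : ((a + b) + (a - b)) % 2 = 0 := by omega
      simp only [bwd]
      rw [if_pos h]
      congr 1
      ext <;> dsimp only <;> omega
    · show bwd (a + b + 1, a - b) = Sum.inr (a, b)
      have h : ¬ ((a + b + 1) + (a - b)) % 2 = 0 := by omega
      simp only [bwd]
      rw [if_neg h]
      congr 1
      ext <;> dsimp only <;> omega
  have hrl : Function.RightInverse bwd fwd := by
    rintro ⟨m, n⟩
    by_cases h : (m + n) % 2 = 0
    · have e : bwd (m, n) = Sum.inl ((m + n) / 2, (m - n) / 2) := by
        simp only [bwd]; rw [if_pos h]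
      rw [e]
      show ((m + n) / 2 + (m - n) / 2, (m + n) / 2 - (m - n) / 2) = (m, n)
      ext <;> dsimp only <;> omega
    · have e : bwd (m, n) = Sum.inr ((m + n - 1) / 2, (m - n - 1) / 2) := by
        simp only [bwd]; rw [if_neg h]
      rw [e]
      show ((m + n - 1) / 2 + (m - n - 1) / 2 + 1, (m + n - 1) / 2 - (m - n - 1) / 2) = (m, n)
      ext <;> dsimp only <;> omega
  let e : (ℤ × ℤ) ⊕ (ℤ × ℤ) ≃ ℤ × ℤ := ⟨fwd, bwd, hlr, hrl⟩
  have h : HasSum (F ∘ e) (s₁ + s₂) := HasSum.sum h₁ h₂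
  exact e.hasSum_iff.mp h

/-- `e^x = e^y` when `x − y ∈ 2πiℤ`. [folklore] -/
theorem cexp_eq_of_sub_eq {x y : ℂ} (n : ℤ) (h : x - y = n * (2 * π * I)) : cexp x = cexp y := by
  rw [show x = y + (x - y) by ring, h, Complex.exp_add, Complex.exp_int_mul_two_pi_mul_I, mul_one]

/-- `e^x = −e^y` when `x − y ∈ πi + 2πiℤ`. [folklore] -/
theorem cexp_eq_neg_of_sub_eq {x y : ℂ} (n : ℤ) (h : x - y = n * (2 * π * I) + π * I) :
    cexp x = -cexp y := by
  rw [show x = y + (x - y) by ring, h, Complex.exp_add, Complex.exp_add,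
    Complex.exp_int_mul_two_pi_mul_I, Complex.exp_pi_mul_I]
  ring

/-! ### The term families and their summability -/

/-- The terms of a theta series are absolutely summable for `Im τ > 0`. [folklore] -/
theorem summable_norm_jacobiTheta₂_term (z : ℂ) {τ : ℂ} (hτ : 0 < im τ) :
    Summable fun n : ℤ => ‖jacobiTheta₂_term n z τ‖ :=
  (summable_pow_mul_jacobiTheta₂_term_bound |im z| hτ 0).of_nonneg_of_le
    (fun _ => norm_nonneg _)
    (by simpa only [pow_zero, one_mul] using norm_jacobiTheta₂_term_le hτ le_rfl le_rfl)

/-- `Im (2τ) > 0`. [folklore] -/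
theorem im_two_mul_pos {τ : ℂ} (hτ : 0 < im τ) : 0 < im (2 * τ) := by
  simpa using hτ

/-- The `ϑ₂`-series: `ϑ₂(τ) = ∑ₙ e^{πiτ/4} θ-term(n, τ/2, τ)`. [folklore] -/
theorem hasSum_theta2 {τ : ℂ} (hτ : 0 < im τ) :
    HasSum (fun n : ℤ => cexp (π * I * τ / 4) * jacobiTheta₂_term n (τ / 2) τ) (theta2 τ) :=
  (hasSum_jacobiTheta₂_term (τ / 2) hτ).mul_left _

/-! ### Pointwise identities behind Landen's transformation -/

section Pointwise

variable (τ : ℂ) (a b : ℤ)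

/-- Equal-parity part of `ϑ₃²`. [folklore] -/
theorem term0_mul_term0_inl :
    jacobiTheta₂_term (a + b) 0 τ * jacobiTheta₂_term (a - b) 0 τ =
      jacobiTheta₂_term a 0 (2 * τ) * jacobiTheta₂_term b 0 (2 * τ) := by
  simp only [jacobiTheta₂_term, ← Complex.exp_add]
  congr 1
  push_cast
  ring

/-- Opposite-parity part of `ϑ₃²`. [folklore] -/
theorem term0_mul_term0_inr :
    jacobiTheta₂_term (a + b + 1) 0 τ * jacobiTheta₂_term (a - b) 0 τ =
      (cexp (π * I * (2 * τ) / 4) * jacobiTheta₂_term a (2 * τ / 2) (2 * τ)) *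
        (cexp (π * I * (2 * τ) / 4) * jacobiTheta₂_term b (2 * τ / 2) (2 * τ)) := by
  simp only [jacobiTheta₂_term, ← Complex.exp_add]
  congr 1
  push_cast
  ring

/-- Equal-parity part of `ϑ₄²`. [folklore] -/
theorem termHalf_mul_termHalf_inl :
    jacobiTheta₂_term (a + b) (1 / 2) τ * jacobiTheta₂_term (a - b) (1 / 2) τ =
      jacobiTheta₂_term a 0 (2 * τ) * jacobiTheta₂_term b 0 (2 * τ) := by
  simp only [jacobiTheta₂_term, ← Complex.exp_add]
  refine cexp_eq_of_sub_eq a ?_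
  push_cast
  ring

/-- Opposite-parity part of `ϑ₄²`. [folklore] -/
theorem termHalf_mul_termHalf_inr :
    jacobiTheta₂_term (a + b + 1) (1 / 2) τ * jacobiTheta₂_term (a - b) (1 / 2) τ =
      -((cexp (π * I * (2 * τ) / 4) * jacobiTheta₂_term a (2 * τ / 2) (2 * τ)) *
        (cexp (π * I * (2 * τ) / 4) * jacobiTheta₂_term b (2 * τ / 2) (2 * τ))) := by
  simp only [jacobiTheta₂_term, ← Complex.exp_add]
  refine cexp_eq_neg_of_sub_eq a ?_
  push_cast
  ring

/-- Equal-parity part of `ϑ₃ϑ₄`. [folklore] -/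
theorem term0_mul_termHalf_inl :
    jacobiTheta₂_term (a + b) 0 τ * jacobiTheta₂_term (a - b) (1 / 2) τ =
      jacobiTheta₂_term a (1 / 2) (2 * τ) * jacobiTheta₂_term b (1 / 2) (2 * τ) := by
  simp only [jacobiTheta₂_term, ← Complex.exp_add]
  refine cexp_eq_of_sub_eq (-b) ?_
  push_cast
  ring

/-- Opposite-parity part of `ϑ₃ϑ₄` is odd under `(a, b) ↦ (a, −1−b)`. [folklore] -/
theorem term0_mul_termHalf_inr_flip :
    jacobiTheta₂_term (a + (-1 - b) + 1) 0 τ * jacobiTheta₂_term (a - (-1 - b)) (1 / 2) τ =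
      -(jacobiTheta₂_term (a + b + 1) 0 τ * jacobiTheta₂_term (a - b) (1 / 2) τ) := by
  simp only [jacobiTheta₂_term, ← Complex.exp_add]
  refine cexp_eq_neg_of_sub_eq b ?_
  push_cast
  ring

end Pointwise

/-! ### Landen's transformation of the thetanulls (Lawden §1.8) -/

section Landen

variable {τ : ℂ}

/-- **Lawden (1.8.2) at `x = 0`: `ϑ₃(τ)² = ϑ₃(2τ)² + ϑ₂(2τ)²`** for `Im τ > 0`.
[cite: Lawden1989, §1.8 eq. (1.8.2)] -/
theorem theta3_sq_eq_of_im_pos (hτ : 0 < im τ) :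
    theta3 τ ^ 2 = theta3 (2 * τ) ^ 2 + theta2 (2 * τ) ^ 2 := by
  have hτ2 := im_two_mul_pos hτ
  set f : ℤ → ℂ := fun n => jacobiTheta₂_term n 0 τ with hf
  have hfs : HasSum f (theta3 τ) := hasSum_jacobiTheta₂_term 0 hτ
  have hfn : Summable fun n => ‖f n‖ := summable_norm_jacobiTheta₂_term 0 hτ
  -- the double series for `ϑ₃(τ)²`
  set F : ℤ × ℤ → ℂ := fun p => f p.1 * f p.2 with hF
  have hF : HasSum F (theta3 τ ^ 2) := by
    rw [sq]; exact hfs.mul hfs (summable_mul_of_summable_norm hfn hfn)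
  -- its two parity parts
  set g : ℤ → ℂ := fun n => jacobiTheta₂_term n 0 (2 * τ) with hg
  have hgs : HasSum g (theta3 (2 * τ)) := hasSum_jacobiTheta₂_term 0 hτ2
  have hgn : Summable fun n => ‖g n‖ := summable_norm_jacobiTheta₂_term 0 hτ2
  set h : ℤ → ℂ := fun n => cexp (π * I * (2 * τ) / 4) * jacobiTheta₂_term n (2 * τ / 2) (2 * τ)
    with hh
  have hhs : HasSum h (theta2 (2 * τ)) := hasSum_theta2 hτ2
  have hhn : Summable fun n => ‖h n‖ := by
    simp only [hh, norm_mul]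
    exact (summable_norm_jacobiTheta₂_term _ hτ2).mul_left _
  have hinl : HasSum (fun p : ℤ × ℤ => F (p.1 + p.2, p.1 - p.2)) (theta3 (2 * τ) ^ 2) := by
    have e : (fun p : ℤ × ℤ => F (p.1 + p.2, p.1 - p.2)) = fun p : ℤ × ℤ => g p.1 * g p.2 := by
      funext ⟨a, b⟩
      exact term0_mul_term0_inl τ a b
    rw [e, sq]
    exact hgs.mul hgs (summable_mul_of_summable_norm hgn hgn)
  have hinr : HasSum (fun p : ℤ × ℤ => F (p.1 + p.2 + 1, p.1 - p.2)) (theta2 (2 * τ) ^ 2) := by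
    have e : (fun p : ℤ × ℤ => F (p.1 + p.2 + 1, p.1 - p.2)) = fun p : ℤ × ℤ => h p.1 * h p.2 := by
      funext ⟨a, b⟩
      exact term0_mul_term0_inr τ a b
    rw [e, sq]
    exact hhs.mul hhs (summable_mul_of_summable_norm hhn hhn)
  exact hF.unique (hasSum_parity_split hinl hinr)

/-- **Lawden (1.8.4) at `x = 0`: `ϑ₄(τ)² = ϑ₃(2τ)² − ϑ₂(2τ)²`** for `Im τ > 0`.
[cite: Lawden1989, §1.8 eq. (1.8.4)] -/
theorem theta4_sq_eq_of_im_pos (hτ : 0 < im τ) :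
    theta4 τ ^ 2 = theta3 (2 * τ) ^ 2 - theta2 (2 * τ) ^ 2 := by
  have hτ2 := im_two_mul_pos hτ
  set f : ℤ → ℂ := fun n => jacobiTheta₂_term n (1 / 2) τ with hf
  have hfs : HasSum f (theta4 τ) := hasSum_jacobiTheta₂_term (1 / 2) hτ
  have hfn : Summable fun n => ‖f n‖ := summable_norm_jacobiTheta₂_term _ hτ
  set F : ℤ × ℤ → ℂ := fun p => f p.1 * f p.2 with hF
  have hF : HasSum F (theta4 τ ^ 2) := by
    rw [sq]; exact hfs.mul hfs (summable_mul_of_summable_norm hfn hfn)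
  set g : ℤ → ℂ := fun n => jacobiTheta₂_term n 0 (2 * τ) with hg
  have hgs : HasSum g (theta3 (2 * τ)) := hasSum_jacobiTheta₂_term 0 hτ2
  have hgn : Summable fun n => ‖g n‖ := summable_norm_jacobiTheta₂_term 0 hτ2
  set h : ℤ → ℂ := fun n => cexp (π * I * (2 * τ) / 4) * jacobiTheta₂_term n (2 * τ / 2) (2 * τ)
    with hh
  have hhs : HasSum h (theta2 (2 * τ)) := hasSum_theta2 hτ2
  have hhn : Summable fun n => ‖h n‖ := by
    simp only [hh, norm_mul]
    exact (summable_norm_jacobiTheta₂_term _ hτ2).mul_left _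
  have hinl : HasSum (fun p : ℤ × ℤ => F (p.1 + p.2, p.1 - p.2)) (theta3 (2 * τ) ^ 2) := by
    have e : (fun p : ℤ × ℤ => F (p.1 + p.2, p.1 - p.2)) = fun p : ℤ × ℤ => g p.1 * g p.2 := by
      funext ⟨a, b⟩
      exact termHalf_mul_termHalf_inl τ a b
    rw [e, sq]
    exact hgs.mul hgs (summable_mul_of_summable_norm hgn hgn)
  have hinr : HasSum (fun p : ℤ × ℤ => F (p.1 + p.2 + 1, p.1 - p.2)) (-(theta2 (2 * τ) ^ 2)) := by
    have e : (fun p : ℤ × ℤ => F (p.1 + p.2 + 1, p.1 - p.2)) =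
        fun p : ℤ × ℤ => -(h p.1 * h p.2) := by
      funext ⟨a, b⟩
      exact termHalf_mul_termHalf_inr τ a b
    rw [e, sq]
    exact (hhs.mul hhs (summable_mul_of_summable_norm hhn hhn)).neg
  rw [sub_eq_add_neg]
  exact hF.unique (hasSum_parity_split hinl hinr)

/-- **Lawden (1.8.3) at `x = 0` / (1.8.7): `ϑ₃(τ)ϑ₄(τ) = ϑ₄(2τ)²`** for `Im τ > 0` (the
opposite-parity part of the double series cancels under `(m,n) ↦ (n,m)`).
[cite: Lawden1989, §1.8 eq. (1.8.7)] -/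
theorem theta3_mul_theta4_of_im_pos (hτ : 0 < im τ) :
    theta3 τ * theta4 τ = theta4 (2 * τ) ^ 2 := by
  have hτ2 := im_two_mul_pos hτ
  set f : ℤ → ℂ := fun n => jacobiTheta₂_term n 0 τ with hf
  set f' : ℤ → ℂ := fun n => jacobiTheta₂_term n (1 / 2) τ with hf'
  have hfs : HasSum f (theta3 τ) := hasSum_jacobiTheta₂_term 0 hτ
  have hfs' : HasSum f' (theta4 τ) := hasSum_jacobiTheta₂_term (1 / 2) hτ
  have hfn : Summable fun n => ‖f n‖ := summable_norm_jacobiTheta₂_term _ hτ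
  have hfn' : Summable fun n => ‖f' n‖ := summable_norm_jacobiTheta₂_term _ hτ
  set F : ℤ × ℤ → ℂ := fun p => f p.1 * f' p.2 with hF
  have hFs : Summable F := summable_mul_of_summable_norm hfn hfn'
  have hF : HasSum F (theta3 τ * theta4 τ) := hfs.mul hfs' hFs
  set g : ℤ → ℂ := fun n => jacobiTheta₂_term n (1 / 2) (2 * τ) with hg
  have hgs : HasSum g (theta4 (2 * τ)) := hasSum_jacobiTheta₂_term (1 / 2) hτ2
  have hgn : Summable fun n => ‖g n‖ := summable_norm_jacobiTheta₂_term _ hτ2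
  have hinl : HasSum (fun p : ℤ × ℤ => F (p.1 + p.2, p.1 - p.2)) (theta4 (2 * τ) ^ 2) := by
    have e : (fun p : ℤ × ℤ => F (p.1 + p.2, p.1 - p.2)) = fun p : ℤ × ℤ => g p.1 * g p.2 := by
      funext ⟨a, b⟩
      exact term0_mul_termHalf_inl τ a b
    rw [e, sq]
    exact hgs.mul hgs (summable_mul_of_summable_norm hgn hgn)
  -- the opposite-parity part `R` is summable and odd under the involution `(a,b) ↦ (a,-1-b)`
  set R : ℤ × ℤ → ℂ := fun p => F (p.1 + p.2 + 1, p.1 - p.2) with hR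
  have hRs : Summable R := hFs.comp_injective parity_inr_injective
  set ψ : ℤ × ℤ ≃ ℤ × ℤ :=
    { toFun := fun p => (p.1, -1 - p.2)
      invFun := fun p => (p.1, -1 - p.2)
      left_inv := fun p => by ext <;> simp
      right_inv := fun p => by ext <;> simp } with hψ
  have hodd : ∀ p, R (ψ p) = -R p := by
    rintro ⟨a, b⟩
    simp only [hR, hψ, Equiv.coe_fn_mk]
    exact term0_mul_termHalf_inr_flip τ a b
  have hR0 : ∑' p, R p = 0 := by
    have h1 : ∑' p, R (ψ p) = ∑' p, R p := ψ.tsum_eq R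
    have h2 : ∑' p, R (ψ p) = -∑' p, R p := by
      rw [← tsum_neg]; exact tsum_congr hodd
    have h3 : (2 : ℂ) * ∑' p, R p = 0 := by rw [two_mul]; nth_rewrite 1 [← h1]; rw [h2]; ring
    exact (mul_eq_zero.mp h3).resolve_left two_ne_zero
  have hinr : HasSum (fun p : ℤ × ℤ => F (p.1 + p.2 + 1, p.1 - p.2)) 0 := by
    rw [← hR0]; exact hRs.hasSum
  have hsum := hasSum_parity_split hinl hinr
  rw [add_zero] at hsum
  exact hF.unique hsum

/-- Off the upper half-plane all thetanulls vanish (Mathlib's junk value). [folklore] -/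
theorem theta_eq_zero_of_im_nonpos (hτ : im τ ≤ 0) :
    theta2 τ = 0 ∧ theta3 τ = 0 ∧ theta4 τ = 0 := by
  refine ⟨?_, jacobiTheta₂_undef 0 hτ, jacobiTheta₂_undef _ hτ⟩
  rw [theta2, jacobiTheta₂_undef _ hτ, mul_zero]

/-- **`ϑ₃(τ)² = ϑ₃(2τ)² + ϑ₂(2τ)²`** for every `τ` (Lawden (1.8.2) at `x = 0`).
[cite: Lawden1989, §1.8 eq. (1.8.2)] -/
theorem theta3_sq_eq (τ : ℂ) : theta3 τ ^ 2 = theta3 (2 * τ) ^ 2 + theta2 (2 * τ) ^ 2 := by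
  by_cases hτ : 0 < im τ
  · exact theta3_sq_eq_of_im_pos hτ
  · have h1 := theta_eq_zero_of_im_nonpos (not_lt.mp hτ)
    have h2 := theta_eq_zero_of_im_nonpos (τ := 2 * τ) (by simp; linarith [not_lt.mp hτ])
    simp [h1.2.1, h2.1, h2.2.1]

/-- **`ϑ₄(τ)² = ϑ₃(2τ)² − ϑ₂(2τ)²`** for every `τ` (Lawden (1.8.4) at `x = 0`).
[cite: Lawden1989, §1.8 eq. (1.8.4)] -/
theorem theta4_sq_eq (τ : ℂ) : theta4 τ ^ 2 = theta3 (2 * τ) ^ 2 - theta2 (2 * τ) ^ 2 := by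
  by_cases hτ : 0 < im τ
  · exact theta4_sq_eq_of_im_pos hτ
  · have h1 := theta_eq_zero_of_im_nonpos (not_lt.mp hτ)
    have h2 := theta_eq_zero_of_im_nonpos (τ := 2 * τ) (by simp; linarith [not_lt.mp hτ])
    simp [h1.2.2, h2.1, h2.2.1]

/-- **Landen / Lawden (1.8.7): `ϑ₄(2τ)² = ϑ₃(τ)ϑ₄(τ)`** for every `τ`.
[cite: Lawden1989, §1.8 eq. (1.8.7)] -/
theorem theta4_two_mul_sq (τ : ℂ) : theta4 (2 * τ) ^ 2 = theta3 τ * theta4 τ := by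
  by_cases hτ : 0 < im τ
  · exact (theta3_mul_theta4_of_im_pos hτ).symm
  · have h1 := theta_eq_zero_of_im_nonpos (not_lt.mp hτ)
    have h2 := theta_eq_zero_of_im_nonpos (τ := 2 * τ) (by simp; linarith [not_lt.mp hτ])
    simp [h1.2.2, h2.2.2]

/-- **Landen / Lawden (1.8.6): `ϑ₃(2τ)² = ½(ϑ₃(τ)² + ϑ₄(τ)²)`** — the arithmetic-mean step.
[cite: Lawden1989, §1.8 eq. (1.8.6)] -/
theorem theta3_two_mul_sq (τ : ℂ) : theta3 (2 * τ) ^ 2 = (theta3 τ ^ 2 + theta4 τ ^ 2) / 2 := by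
  rw [theta3_sq_eq τ, theta4_sq_eq τ]
  ring

/-- **Landen / Lawden (1.8.5): `ϑ₂(2τ)² = ½(ϑ₃(τ)² − ϑ₄(τ)²)`.**
[cite: Lawden1989, §1.8 eq. (1.8.5)] -/
theorem theta2_two_mul_sq (τ : ℂ) : theta2 (2 * τ) ^ 2 = (theta3 τ ^ 2 - theta4 τ ^ 2) / 2 := by
  rw [theta3_sq_eq τ, theta4_sq_eq τ]
  ring

end Landen

/-! ### The thetanulls on the imaginary axis perform the AGM -/

section Axis

variable {y : ℝ}

/-- `ϑ₃(2iy)² = ½(ϑ₃(iy)² + ϑ₄(iy)²)` for the (real, positive) axis values. [cite: Lawden1989, §1.8 eq. (1.8.6)] -/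
theorem theta3_re_sq_two_mul (hy : 0 < y) :
    (theta3 (I * ↑(2 * y))).re ^ 2 = ((theta3 (I * y)).re ^ 2 + (theta4 (I * y)).re ^ 2) / 2 := by
  have h2y : 0 < 2 * y := by positivity
  have h := theta3_two_mul_sq (I * y)
  rw [show (2 : ℂ) * (I * y) = I * ↑(2 * y) by push_cast; ring, theta3_I_mul_eq_re h2y,
    theta3_I_mul_eq_re hy, theta4_I_mul_eq_re hy] at h
  exact_mod_cast h

/-- `ϑ₄(2iy)² = ϑ₃(iy)ϑ₄(iy)` for the axis values. [cite: Lawden1989, §1.8 eq. (1.8.7)] -/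
theorem theta4_re_sq_two_mul (hy : 0 < y) :
    (theta4 (I * ↑(2 * y))).re ^ 2 = (theta3 (I * y)).re * (theta4 (I * y)).re := by
  have h2y : 0 < 2 * y := by positivity
  have h := theta4_two_mul_sq (I * y)
  rw [show (2 : ℂ) * (I * y) = I * ↑(2 * y) by push_cast; ring, theta4_I_mul_eq_re h2y,
    theta3_I_mul_eq_re hy, theta4_I_mul_eq_re hy] at h
  exact_mod_cast h

/-- `ϑ₂(2iy)² = ½(ϑ₃(iy)² − ϑ₄(iy)²)` for the axis values. [cite: Lawden1989, §1.8 eq. (1.8.5)] -/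
theorem theta2_re_sq_two_mul (hy : 0 < y) :
    (theta2 (I * ↑(2 * y))).re ^ 2 = ((theta3 (I * y)).re ^ 2 - (theta4 (I * y)).re ^ 2) / 2 := by
  have h2y : 0 < 2 * y := by positivity
  have h := theta2_two_mul_sq (I * y)
  rw [show (2 : ℂ) * (I * y) = I * ↑(2 * y) by push_cast; ring, theta2_I_mul_eq_re h2y,
    theta3_I_mul_eq_re hy, theta4_I_mul_eq_re hy] at h
  exact_mod_cast h

/-- **The AGM of the theta squares**: Mathlib's `agmSequences` started at
`(ϑ₃(iy)², ϑ₄(iy)²)` is `n ↦ (ϑ₄(2ⁿ⁺¹iy)², ϑ₃(2ⁿ⁺¹iy)²)` (geometric, arithmetic means).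
[cite: BorweinBorwein1987, Thm 2.1 / (2.1.13)] -/
theorem agmSequences_thetaSq (hy : 0 < y) (n : ℕ) :
    agmSequences ((theta3 (I * y)).re ^ 2).toNNReal ((theta4 (I * y)).re ^ 2).toNNReal n =
      (((theta4 (I * ↑(2 ^ (n + 1) * y))).re ^ 2).toNNReal,
        ((theta3 (I * ↑(2 ^ (n + 1) * y))).re ^ 2).toNNReal) := by
  induction n with
  | zero =>
    rw [agmSequences_zero]
    have h3 := theta3_I_mul_re_pos hy
    have h4 := theta4_I_mul_re_pos hy
    ext
    · -- geometric mean
      rw [Real.coe_sqrt, NNReal.coe_mul, Real.coe_toNNReal _ (sq_nonneg _),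
        Real.coe_toNNReal _ (sq_nonneg _), Real.coe_toNNReal _ (sq_nonneg _),
        show (2 : ℝ) ^ (0 + 1) * y = 2 * y by ring, theta4_re_sq_two_mul hy,
        show (theta3 (I * ↑y)).re ^ 2 * (theta4 (I * ↑y)).re ^ 2 =
          ((theta3 (I * ↑y)).re * (theta4 (I * ↑y)).re) ^ 2 by ring,
        Real.sqrt_sq (mul_pos h3 h4).le]
    · -- arithmetic mean
      rw [NNReal.coe_div, NNReal.coe_add, NNReal.coe_ofNat, Real.coe_toNNReal _ (sq_nonneg _),
        Real.coe_toNNReal _ (sq_nonneg _), Real.coe_toNNReal _ (sq_nonneg _),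
        show (2 : ℝ) ^ (0 + 1) * y = 2 * y by ring, theta3_re_sq_two_mul hy]
  | succ n ih =>
    rw [agmSequences_succ', ih]
    set y' : ℝ := 2 ^ (n + 1) * y with hy'
    have hy'0 : 0 < y' := by positivity
    have h3 := theta3_I_mul_re_pos hy'0
    have h4 := theta4_I_mul_re_pos hy'0
    have e : (2 : ℝ) ^ (n + 1 + 1) * y = 2 * y' := by rw [hy']; ring
    ext
    · rw [Real.coe_sqrt, NNReal.coe_mul, Real.coe_toNNReal _ (sq_nonneg _),
        Real.coe_toNNReal _ (sq_nonneg _), Real.coe_toNNReal _ (sq_nonneg _), e,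
        theta4_re_sq_two_mul hy'0,
        show (theta4 (I * ↑y')).re ^ 2 * (theta3 (I * ↑y')).re ^ 2 =
          ((theta3 (I * ↑y')).re * (theta4 (I * ↑y')).re) ^ 2 by ring,
        Real.sqrt_sq (mul_pos h3 h4).le]
    · rw [NNReal.coe_div, NNReal.coe_add, NNReal.coe_ofNat, Real.coe_toNNReal _ (sq_nonneg _),
        Real.coe_toNNReal _ (sq_nonneg _), Real.coe_toNNReal _ (sq_nonneg _), e,
        theta3_re_sq_two_mul hy'0]
      ring

/-- `ϑ₃(i·2ⁿ⁺¹y) → 1` as `n → ∞` (`y > 0`). [folklore] -/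
theorem tendsto_theta3_re_pow_two_mul (hy : 0 < y) :
    Tendsto (fun n : ℕ => (theta3 (I * ↑(2 ^ (n + 1) * y))).re) atTop (𝓝 1) := by
  have h1 : Tendsto (fun n : ℕ => (I * ↑(2 ^ (n + 1) * y) : ℂ)) atTop (comap im atTop) := by
    rw [tendsto_comap_iff]
    have e : im ∘ (fun n : ℕ => (I * ↑(2 ^ (n + 1) * y) : ℂ)) = fun n : ℕ => 2 ^ (n + 1) * y := by
      funext n
      simp only [Function.comp_apply, Complex.mul_im, Complex.I_re, Complex.I_im,
        Complex.ofReal_re, Complex.ofReal_im, zero_mul, one_mul, zero_add]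
    rw [e]
    refine Tendsto.atTop_mul_const hy ?_
    exact (tendsto_pow_atTop_atTop_of_one_lt one_lt_two).comp (tendsto_add_atTop_nat 1)
  have h2 := (tendsto_theta3.comp h1)
  have h3 := (Complex.continuous_re.tendsto 1).comp h2
  rw [Complex.one_re] at h3
  exact h3

/-- **`M(ϑ₃(iy)², ϑ₄(iy)²) = 1`**: the AGM of the theta squares is `1` (`ϑ₃, ϑ₄ → 1` at `i∞`).
[cite: BorweinBorwein1987, Thm 2.1 / (2.1.13)] -/
theorem agm_thetaSq_eq_one (hy : 0 < y) :
    ((theta3 (I * y)).re ^ 2).toNNReal.agm ((theta4 (I * y)).re ^ 2).toNNReal = 1 := by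
  have h1 := tendsto_agmSequences_snd_agm (x := ((theta3 (I * y)).re ^ 2).toNNReal)
    (y := ((theta4 (I * y)).re ^ 2).toNNReal)
  have e : (fun n => (agmSequences ((theta3 (I * y)).re ^ 2).toNNReal
      ((theta4 (I * y)).re ^ 2).toNNReal n).2) =
      fun n : ℕ => ((theta3 (I * ↑(2 ^ (n + 1) * y))).re ^ 2).toNNReal := by
    funext n; rw [agmSequences_thetaSq hy n]
  rw [e] at h1
  have h2 : Tendsto (fun n : ℕ => ((theta3 (I * ↑(2 ^ (n + 1) * y))).re ^ 2).toNNReal) atTop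
      (𝓝 ((1 : ℝ) ^ 2).toNNReal) :=
    (continuous_real_toNNReal.tendsto _).comp ((tendsto_theta3_re_pow_two_mul hy).pow 2)
  rw [one_pow, Real.toNNReal_one] at h2
  exact tendsto_nhds_unique h1 h2

/-! ### Jacobi's inversion theorem on the imaginary axis -/

/-- **Jacobi's inversion theorem, `K = ½πϑ₃²`** (Lawden (2.2.3) with (2.1.7), (3.1.3)): for
`y > 0`, with the elliptic modulus `k² = λ(iy) = ϑ₂(iy)⁴/ϑ₃(iy)⁴` (`KlebanZagier.lamR`),
`K(k) = ∫₀¹ dt/√((1−t²)(1−k²t²)) = ellipticK (λ(iy)) = (π/2) ϑ₃(iy)²`. Proof: Gauss's theorem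
`K(1 − b²/a²) = πa/(2M(a,b))` at `(a,b) = (ϑ₃², ϑ₄²)`, `M = 1`, and `1 − ϑ₄⁴/ϑ₃⁴ = ϑ₂⁴/ϑ₃⁴`
(Jacobi's quartic identity). [cite: Lawden1989, §2.2 eq. (2.2.3) and §3.1 eq. (3.1.3)] -/
theorem ellipticK_lamR (hy : 0 < y) :
    ellipticK (lamR y) = π / 2 * (theta3 (I * y)).re ^ 2 := by
  have h3 := theta3_I_mul_re_pos hy
  have h4 := theta4_I_mul_re_pos hy
  have hG := ellipticK_eq_pi_mul_div_agm (pow_pos h3 2) (pow_pos h4 2)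
  rw [agm_thetaSq_eq_one hy] at hG
  have e : 1 - ((theta4 (I * y)).re ^ 2) ^ 2 / ((theta3 (I * y)).re ^ 2) ^ 2 = lamR y := by
    have h := one_sub_lamR hy
    have e4 : ((theta4 (I * y)).re ^ 2) ^ 2 / ((theta3 (I * y)).re ^ 2) ^ 2 =
        (theta4 (I * y)).re ^ 4 / (theta3 (I * y)).re ^ 4 := by ring
    rw [e4, ← h]
    ring
  rw [e] at hG
  rw [hG]
  push_cast
  ring

/-- `ϑ₃(i/y)² = y·ϑ₃(iy)²` (the `S`-law `ϑ₃(−1/τ) = (−iτ)^{1/2}ϑ₃(τ)` on the axis).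
[cite: Lawden1989, §1.7 eq. (1.7.12)] -/
theorem theta3_re_inv_sq (hy : 0 < y) :
    (theta3 (I * ↑(y⁻¹))).re ^ 2 = y * (theta3 (I * y)).re ^ 2 := by
  have him : 0 < im (I * y : ℂ) := by simpa using hy
  have h3 : theta3 (I * (y⁻¹ : ℝ)) = ((y ^ (1 / 2 : ℝ) : ℝ) : ℂ) * theta3 (I * y) := by
    have h := theta3_neg_one_div him
    rwa [neg_one_div_I_mul hy, cpow_half_I_mul hy] at h
  rw [h3, theta3_I_mul_eq_re hy, ← Complex.ofReal_mul, Complex.ofReal_re, Complex.ofReal_re,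
    mul_pow, ← Real.rpow_natCast, ← Real.rpow_mul hy.le]
  norm_num

/-- `ϑ₄(i/y)² = y·ϑ₂(iy)²` (the `S`-law `ϑ₄(−1/τ) = (−iτ)^{1/2}ϑ₂(τ)` on the axis).
[cite: Lawden1989, §1.7 eq. (1.7.13)] -/
theorem theta4_re_inv_sq (hy : 0 < y) :
    (theta4 (I * ↑(y⁻¹))).re ^ 2 = y * (theta2 (I * y)).re ^ 2 := by
  have hy' : 0 < y⁻¹ := inv_pos.mpr hy
  have h4 : theta4 (I * (y⁻¹ : ℝ)) = (((y⁻¹) ^ (-(1 / 2 : ℝ)) : ℝ) : ℂ) * theta2 (I * y) := by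
    have h := theta4_I_mul hy'
    rwa [inv_inv] at h
  rw [h4, theta2_I_mul_eq_re hy, ← Complex.ofReal_mul, Complex.ofReal_re, Complex.ofReal_re,
    mul_pow, ← Real.rpow_natCast, ← Real.rpow_mul hy'.le, Real.inv_rpow hy.le, ← Real.rpow_neg_one,
    ← Real.rpow_mul hy.le]
  norm_num

/-- **The modulus and its complement swap under `y ↦ 1/y`**: `√λ(iy) = ϑ₂²/ϑ₃²(iy) = ϑ₄²/ϑ₃²(i/y)`.
[cite: Lawden1989, §2.1 eq. (2.1.7) with §1.7] -/
theorem sqrt_lamR_eq (y : ℝ) :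
    Real.sqrt (lamR y) = (theta2 (I * y)).re ^ 2 / (theta3 (I * y)).re ^ 2 := by
  rw [lamR, show (theta2 (I * y)).re ^ 4 / (theta3 (I * y)).re ^ 4 =
      ((theta2 (I * y)).re ^ 2 / (theta3 (I * y)).re ^ 2) ^ 2 by ring,
    Real.sqrt_sq (div_nonneg (sq_nonneg _) (sq_nonneg _))]

/-- `√λ(iy) = ϑ₄(i/y)²/ϑ₃(i/y)²` (`k(iy) = k′(i/y)`). [cite: Lawden1989, §2.1 eq. (2.1.7) with §1.7] -/
theorem sqrt_lamR_eq_compl_inv (hy : 0 < y) :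
    Real.sqrt (lamR y) = (theta4 (I * ↑(y⁻¹))).re ^ 2 / (theta3 (I * ↑(y⁻¹))).re ^ 2 := by
  rw [sqrt_lamR_eq y, theta4_re_inv_sq hy, theta3_re_inv_sq hy,
    mul_div_mul_left _ _ hy.ne']

/-- **Landen's transformation of the modulus** on the axis: `√λ(2iy) = (ϑ₃² − ϑ₄²)/(ϑ₃² + ϑ₄²)(iy)`
(`k(q²) = (1−k′)/(1+k′)`). [cite: Lawden1989, §1.8 eqs. (1.8.5)–(1.8.6)] -/
theorem sqrt_lamR_two_mul (hy : 0 < y) :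
    Real.sqrt (lamR (2 * y)) =
      ((theta3 (I * y)).re ^ 2 - (theta4 (I * y)).re ^ 2) /
        ((theta3 (I * y)).re ^ 2 + (theta4 (I * y)).re ^ 2) := by
  have h3 := theta3_I_mul_re_pos hy
  rw [sqrt_lamR_eq (2 * y), theta2_re_sq_two_mul hy, theta3_re_sq_two_mul hy,
    div_div_div_cancel_right₀ (two_ne_zero)]

/-- **`(1 − k)/(1 + k) = k(2i/y)` for `k = √λ(iy)`**: the descending Landen step composed with the
`S`-law (`(1−k(iy))/(1+k(iy)) = (1−k′(i/y))/(1+k′(i/y)) = k(2i/y)`). This is what identifies the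
Cardy cross-ratio `((1−k)/(1+k))²` of a rectangle with `λ` at its aspect ratio.
[cite: Lawden1989, §1.8 eqs. (1.8.5)–(1.8.6) and §1.7] -/
theorem one_sub_sqrt_lamR_div (hy : 0 < y) :
    (1 - Real.sqrt (lamR y)) / (1 + Real.sqrt (lamR y)) = Real.sqrt (lamR (2 * y⁻¹)) := by
  have hy' : 0 < y⁻¹ := inv_pos.mpr hy
  have h3 := theta3_I_mul_re_pos hy'
  have h3' : (theta3 (I * ↑(y⁻¹))).re ^ 2 ≠ 0 := (pow_pos h3 2).ne'
  rw [sqrt_lamR_eq_compl_inv hy, sqrt_lamR_two_mul hy', one_sub_div h3', one_add_div h3',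
    div_div_div_cancel_right₀ h3']

/-- **`K′/K = y`: `ellipticK (1 − λ(iy)) = y · ellipticK (λ(iy))`** for `y > 0`, i.e. with
`k² = λ(iy)`: `K′(k) = K(k′) = y K(k)` — Lawden's `iK′ = τK` (2.2.3) at `τ = iy`, together with
(3.1.4) `K′(k) = ∫₀¹ dt/√((1−t²)(1−k′²t²))`. Proof: `1 − λ(iy) = λ(i/y)` and
`ϑ₃(i/y)² = yϑ₃(iy)²`. Equivalently the nome is `q = e^{−πK′/K}`.
[cite: Lawden1989, §2.2 eq. (2.2.3) and §3.1 eq. (3.1.4)] -/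
theorem ellipticK_one_sub_lamR (hy : 0 < y) :
    ellipticK (1 - lamR y) = y * ellipticK (lamR y) := by
  rw [← lamR_inv hy, ellipticK_lamR (inv_pos.mpr hy), ellipticK_lamR hy, theta3_re_inv_sq hy]
  ring

/-- The same with the tree's `modularLambdaI` (`= lamR`): `ellipticK (λ(iy)) = (π/2)ϑ₃(iy)²`.
[cite: Lawden1989, §2.2 eq. (2.2.3)] -/
theorem ellipticK_modularLambdaI (hy : 0 < y) :
    ellipticK (modularLambdaI y) = π / 2 * (theta3 (I * y)).re ^ 2 := by
  rw [modularLambdaI_eq_lamR hy, ellipticK_lamR hy]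

/-- `ellipticK (1 − λ(iy)) = y · ellipticK (λ(iy))` with the tree's `modularLambdaI`.
[cite: Lawden1989, §2.2 eq. (2.2.3)] -/
theorem ellipticK_one_sub_modularLambdaI (hy : 0 < y) :
    ellipticK (1 - modularLambdaI y) = y * ellipticK (modularLambdaI y) := by
  rw [modularLambdaI_eq_lamR hy, ellipticK_one_sub_lamR hy]

/-! ### Singular moduli -/

/-- **The `N`-th singular modulus is `√λ(i√N)`**: `k = √λ(i√N)` satisfies `0 < k < 1` and
`K′(k) = √N K(k)`, i.e. `ellipticK (1 − k²) = √N · ellipticK (k²)`.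
[cite: BorweinBorwein1987, Thm 2.3] -/
theorem sqrt_lamR_isSingularModulus {N : ℝ} (hN : 0 < N) :
    0 < Real.sqrt (lamR (Real.sqrt N)) ∧ Real.sqrt (lamR (Real.sqrt N)) < 1 ∧
      ellipticK (1 - Real.sqrt (lamR (Real.sqrt N)) ^ 2) =
        Real.sqrt N * ellipticK (Real.sqrt (lamR (Real.sqrt N)) ^ 2) := by
  have hs : 0 < Real.sqrt N := Real.sqrt_pos.mpr hN
  have hl := lamR_mem_Ioo hs
  refine ⟨Real.sqrt_pos.mpr hl.1, ?_, ?_⟩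
  · rw [show (1 : ℝ) = Real.sqrt 1 by simp]
    exact Real.sqrt_lt_sqrt hl.1.le hl.2
  · rw [Real.sq_sqrt hl.1.le]
    exact ellipticK_one_sub_lamR hs

/-- **Every singular modulus is a theta quotient**: if `0 < k < 1` and `K′(k) = √N K(k)`
(`N > 0`), then `k² = λ(i√N) = ϑ₂(i√N)⁴/ϑ₃(i√N)⁴` (uniqueness of the singular modulus,
`existsUnique_singularModulus`). [cite: BorweinBorwein1987, Thm 2.3] -/
theorem singularModulus_sq_eq_lamR {N k : ℝ} (hN : 0 < N) (hk0 : 0 < k) (hk1 : k < 1)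
    (hk : ellipticK (1 - k ^ 2) = Real.sqrt N * ellipticK (k ^ 2)) :
    k ^ 2 = lamR (Real.sqrt N) := by
  obtain ⟨k₀, -, huniq⟩ := existsUnique_singularModulus hN
  obtain ⟨h0, h1, h⟩ := sqrt_lamR_isSingularModulus hN
  have e1 : k = k₀ := huniq k ⟨hk0, hk1, hk⟩
  have e2 : Real.sqrt (lamR (Real.sqrt N)) = k₀ := huniq _ ⟨h0, h1, h⟩
  rw [e1, ← e2, Real.sq_sqrt (lamR_mem_Ioo (Real.sqrt_pos.mpr hN)).1.le]

/-- **`K(k_N) = (π/2) ϑ₃(i√N)²`**: at the `N`-th singular modulus (`0 < k < 1`,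
`K′(k) = √N K(k)`) the complete elliptic integral is a thetanull square.
[cite: BorweinBorwein1987, Thm 2.3] -/
theorem ellipticK_singularModulus_eq {N k : ℝ} (hN : 0 < N) (hk0 : 0 < k) (hk1 : k < 1)
    (hk : ellipticK (1 - k ^ 2) = Real.sqrt N * ellipticK (k ^ 2)) :
    ellipticK (k ^ 2) = π / 2 * (theta3 (I * ↑(Real.sqrt N))).re ^ 2 := by
  rw [singularModulus_sq_eq_lamR hN hk0 hk1 hk, ellipticK_lamR (Real.sqrt_pos.mpr hN)]

/-- And the complementary integral: `K′(k_N) = √N (π/2) ϑ₃(i√N)²`. [cite: BorweinBorwein1987, Thm 2.3] -/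
theorem ellipticK_compl_singularModulus_eq {N k : ℝ} (hN : 0 < N) (hk0 : 0 < k) (hk1 : k < 1)
    (hk : ellipticK (1 - k ^ 2) = Real.sqrt N * ellipticK (k ^ 2)) :
    ellipticK (1 - k ^ 2) = Real.sqrt N * (π / 2 * (theta3 (I * ↑(Real.sqrt N))).re ^ 2) := by
  rw [hk, ellipticK_singularModulus_eq hN hk0 hk1 hk]

end Axis

end Literature.Analysis.SpecialFunctions
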